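import Summits.QuantumFields.YangMills.Theorems.AllWindowsColdBoxBoxHighLineBoxToChartReductionWindow
import Summits.QuantumFields.YangMills.Theorems.AllWindowsColdBoxBoxHighLineBoxToChartRarityFloor
import Summits.QuantumFields.YangMills.Theorems.AllWindowsColdBoxBoxHighLineErrorBudget

/-!
# T-S5.13A in RELATIVE form — the `ε₁ = 1/8` half of ✓`landauRelativeComparisonBulk_of_split` (ASSEMBLY-S5 Steps A+B+C with the §1 parameters;
# LINE-19 S5 ⟨stmt-QuantumFields-24004⟩/⟨24335⟩; LEAD sfw-p2 g77's target shape 2026-08-29T20:53:17Z)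

Width seat `ym-line-sfw-p2-w2` (g31).  For exponents `0 < θ`, `θ/2 < κ₃ < ε₁`, **`2θ < ε₁`** (rarity entropy — see ✓`…BoxToChartRarityFloor`),
`ε₁ < 1/2 − 4θ` (hence `12θ < 1`), `ε₁ < 1/2 − 6θ + 2κ₃`, and given ✓T-S5.6 `SmallFieldInsideFP` (a tree theorem modulo the 6b one-liner), with
`H = ⌈β^θ⌉₊`, `s = β^{κ₃−1/2}`, `spl = β^{ε₁−1/2}`, `r = K·H·(1+log H)²·spl + 1/(H⁴(1+log β)²)` (`K = √C_{4b}` of ✓S4b):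

  `∃ K M L β₀, ∀ β ≥ β₀, ∀ T (L ≤ T, M·T ≤ H):  |β²·boxPlaqCov β H T − β²·(⟨c₀c_T⟩_D − ⟨c₀⟩_D⟨c_T⟩_D)| ≤ (1/8)·((3/4)·boxDirCircSqCov H T)`,

`⟨G⟩_D = ∫_D G(U a) w_J/∫_D w_J`, `D = smallField H s`, `w_J = fpChartWeight β H r` — i.e. the hypothesis `hAC` of ✓`mainApprox_of_split` with `ε₁ = 1/8`,
`M = 8·M_D`, `L = L_D`.  Proof: ✓`boxPlaqCov_sub_chartCov_le_window'` (absolute `200(e^{−cH⁴} + p + τ)`), ✓`exists_forall_boxState_not_smallPlaquettes_le`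
(`p ≤ e^{−β^{ε₁}}`), `τ = C₆H⁴exp(C₆rH⁵ − c₆βs²)` with `rH⁵ ≤ 2β^θ + 64K(2+θ)²β^{6θ+ε₁−1/2}(1+log β)²`, the floor ✓`boxDirCircSqCov_floor_H`
(`(3/4)bDCSC ≥ 3/(32π⁴H⁸)`), and fifteen largeness conditions, each an instance of ✓`ErrorBudget.*`.

Everything proved, tree only; no definitions; standard axioms.
HONEST LABEL: bookkeeping for the T-S5.13 assembly of the XL stub S5 (`stub_landauSecondOrder`) of a critic-PASSed DRAFT line; the other half (Steps D–E, 13E)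
is the LEAD's; S5, U5, ⟨24004⟩ ⟨24335⟩ ⟨24336⟩ remain OPEN; no stub is closed by name, no crux, rung or summit is proved; **the Yang–Mills mass gap is NOT
proved by this file.**
-/

set_option autoImplicit false

noncomputable section

open MeasureTheory Real
open Literature.Probability.LatticeModels (Site)
open Literature.MathematicalPhysics.QuantumLattice (LGConfig fundamentalRep)
open Summit.QuantumFields.YangMills.Theorems.WeakCouplingRates (boxState boxCentre boxPlaqCov boxDirCircSqCov)

namespace Summit.QuantumFields.YangMills.Theorems.AllWindowsColdBoxBoxHighLine

namespace BoxToChart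

open ErrorBudget

/-! ## The box side `H = ⌈β^θ⌉₊` -/

/-- `β^θ ≤ ⌈β^θ⌉₊ ≤ β^θ + 1` and `1 ≤ ⌈β^θ⌉₊` for `β ≥ 1`. -/
theorem ceil_rpow_bounds {β θ : ℝ} (hβ : 1 ≤ β) :
    β ^ θ ≤ (⌈β ^ θ⌉₊ : ℝ) ∧ (⌈β ^ θ⌉₊ : ℝ) ≤ β ^ θ + 1 ∧ 1 ≤ ⌈β ^ θ⌉₊ := by
  have h0 : 0 < β ^ θ := Real.rpow_pos_of_pos (by linarith) θ
  refine ⟨Nat.le_ceil _, (Nat.ceil_lt_add_one h0.le).le, ?_⟩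
  exact Nat.one_le_iff_ne_zero.2 (Nat.pos_iff_ne_zero.1 (Nat.ceil_pos.2 h0))

/-! ## The relative form -/

/-- ★★★ **T-S5.13A in relative form (the `ε₁ = 1/8` half of ✓`landauRelativeComparisonBulk_of_split`).** -/
theorem boxPlaqCov_sub_chartCov_relative (h6 : SmallFieldInsideFP) {θ κ₃ ε₁ : ℝ} (hθ : 0 < θ)
    (hκl : θ / 2 < κ₃) (hε₁l : κ₃ < ε₁) (hε₁θ : 2 * θ < ε₁) (hε₁u : ε₁ < 1 / 2 - 4 * θ)
    (hε₁u' : ε₁ < 1 / 2 - 6 * θ + 2 * κ₃) :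
    ∃ K M L : ℝ, 0 < K ∧ 1 ≤ M ∧ 1 ≤ L ∧ ∃ β₀ : ℝ, 1 ≤ β₀ ∧ ∀ β : ℝ, β₀ ≤ β → ∀ T : ℕ, L ≤ (T : ℝ) → M * (T : ℝ) ≤ (⌈β ^ θ⌉₊ : ℝ) →
      ∀ (H : ℕ) (s spl r : ℝ), H = ⌈β ^ θ⌉₊ → s = β ^ (κ₃ - 1 / 2) → spl = β ^ (ε₁ - 1 / 2) →
        r = K * H * (1 + Real.log H) ^ 2 * spl + 1 / ((H : ℝ) ^ 4 * (1 + Real.log β) ^ 2) →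
      |β ^ 2 * boxPlaqCov (fundamentalRep (Fin 2)) β H T -
          β ^ 2 * ((∫ a in smallField H s, chartPlaqCost H (boxCentre H) 1 2 a * chartPlaqCost H (boxCentre H + Pi.single 0 (T : ℤ)) 1 2 a *
                fpChartWeight β H r a) / (∫ a in smallField H s, fpChartWeight β H r a) -
            (∫ a in smallField H s, chartPlaqCost H (boxCentre H) 1 2 a * fpChartWeight β H r a) /
                (∫ a in smallField H s, fpChartWeight β H r a) *
              ((∫ a in smallField H s, chartPlaqCost H (boxCentre H + Pi.single 0 (T : ℤ)) 1 2 a * fpChartWeight β H r a) /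
                (∫ a in smallField H s, fpChartWeight β H r a)))| ≤
        1 / 8 * (3 / 4 * boxDirCircSqCov H T) := by
  obtain ⟨K, C₅, c₅, c₀₅, hK, hC₅, hc₅, hc₀₅, hwin⟩ := boxPlaqCov_sub_chartCov_le_window'
  obtain ⟨C₆, c₆, c₀₆, hc₆, hc₀₆, h6'⟩ := h6
  obtain ⟨M_D, L_D, hM, hL, hfloor⟩ := boxDirCircSqCov_floor_H
  obtain ⟨β₁, hβ₁1, hp⟩ := exists_forall_boxState_not_smallPlaquettes_le hθ hε₁θ
  obtain ⟨C₆p, hC₆p⟩ : ∃ x : ℝ, x = max C₆ 0 := ⟨_, rfl⟩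
  have hC₆p0 : 0 ≤ C₆p := by rw [hC₆p]; exact le_max_right _ _
  have hC₆le : C₆ ≤ C₆p := by rw [hC₆p]; exact le_max_left _ _
  have hθ0 : 0 ≤ θ := hθ.le
  obtain ⟨Q, hQ⟩ : ∃ x : ℝ, x = 200 * 24 * (32 * π ^ 4 / 3) := ⟨_, rfl⟩
  have hQ0 : 0 < Q := by rw [hQ]; positivity
  -- the largeness conditions (ErrorBudget instances)
  obtain ⟨b₁, hb₁1, hb₁⟩ := exists_forall_natPow_log_le (k := 12) (γ := 1) hθ0 (by push_cast; linarith) one_pos C₅ 0 8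
  obtain ⟨b₂, -, hb₂⟩ := exists_forall_natPow_exp_le (γ := 4 * θ) hθ0 (by positivity) hc₅ (by norm_num : (0 : ℝ) < 1 / 2) 1 0 0
  obtain ⟨b₃, -, hb₃⟩ := exists_forall_natPow_log_le (k := 4) (γ := 1 / 2 - ε₁) hθ0 (by push_cast; linarith) hc₀₅ 1 2 0
  obtain ⟨b₄, -, hb₄⟩ := exists_forall_natPow_log_le (k := 3) (γ := 1 / 2 - ε₁) hθ0 (by push_cast; linarith) one_pos (C₅ * K) 2 0
  obtain ⟨b₅, -, hb₅⟩ := exists_forall_natPow_log_le (k := 2) (γ := 1 / 2 - ε₁) hθ0 (by push_cast; linarith)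
    (by norm_num : (0 : ℝ) < 1 / 2) (C₅ * K) 2 0
  obtain ⟨b₆, -, hb₆⟩ := exists_forall_log_pow_div_rpow_le (γ := 3 * θ) (by positivity) (by norm_num : (0 : ℝ) < 1 / 2) C₅ 0
  obtain ⟨b₇, -, hb₇⟩ := exists_forall_log_pow_div_rpow_le (γ := 1 / 2 - κ₃) (by linarith) (by norm_num : (0 : ℝ) < 1 / 100) 1 0
  obtain ⟨b₈, -, hb₈⟩ := exists_forall_log_pow_div_rpow_le (γ := 2 * (ε₁ - κ₃)) (by linarith) one_pos 17 0
  obtain ⟨b₉, -, hb₉⟩ := exists_forall_log_pow_div_rpow_le (γ := 1 / 2 - κ₃ - 4 * θ) (by linarith) one_pos 64 2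
  obtain ⟨b₁₀, -, hb₁₀⟩ := exists_forall_natPow_log_le (k := 3) (γ := 1 / 2 - ε₁) hθ0 (by push_cast; linarith)
    (by positivity : (0 : ℝ) < c₀₆ / 2) K 2 0
  obtain ⟨b₁₁, -, hb₁₁⟩ := exists_forall_log_pow_div_rpow_le (γ := 2 * θ) (by positivity) (by positivity : (0 : ℝ) < c₀₆ / 2) 1 0
  obtain ⟨b₁₂, -, hb₁₂⟩ := exists_forall_natPow_log_le (k := 0) (γ := 2 * κ₃) hθ0 (by push_cast; linarith) one_pos C₆ 1 0
  obtain ⟨b₁₃, -, hb₁₃⟩ := exists_forall_log_pow_div_rpow_le (γ := θ) hθ one_pos 32 0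
  obtain ⟨b₁₄, -, hb₁₄⟩ := exists_forall_natPow_exp_le (γ := 4 * θ) hθ0 (by positivity) hc₅ one_pos Q 2 8
  obtain ⟨b₁₅, -, hb₁₅⟩ := exists_forall_natPow_exp_le (γ := ε₁) hθ0 (by linarith) one_pos one_pos Q 2 8
  obtain ⟨b₁₆, -, hb₁₆⟩ := exists_forall_natPow_exp_sub_le (γ₁ := θ) (γ₁' := 6 * θ + ε₁ - 1 / 2) (γ₂ := 2 * κ₃) hθ0 (by linarith)
    (by linarith) (by linarith) hc₆ one_pos (Q * C₆p) 2 (2 * C₆p) (64 * K * (2 + θ) ^ 2 * C₆p) 12 2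
  -- the threshold
  refine ⟨K, 8 * M_D, L_D, hK, by linarith, hL, max (max (max (max 2 β₁) (max b₁ b₂)) (max (max b₃ b₄) (max b₅ b₆)))
    (max (max (max b₇ b₈) (max b₉ b₁₀)) (max (max b₁₁ b₁₂) (max (max b₁₃ b₁₄) (max b₁₅ b₁₆)))),
    le_max_of_le_left (le_max_of_le_left (le_max_of_le_left (le_max_of_le_left (by norm_num)))), ?_⟩
  intro β hβ T hLT hMT H s spl r hHdef hsdef hspldef hrdef
  simp only [max_le_iff] at hβ
  obtain ⟨⟨⟨⟨hβ2, hββ₁⟩, hβb₁, hβb₂⟩, ⟨hβb₃, hβb₄⟩, hβb₅, hβb₆⟩, ⟨⟨hβb₇, hβb₈⟩, hβb₉, hβb₁₀⟩, ⟨hβb₁₁, hβb₁₂⟩, ⟨hβb₁₃, hβb₁₄⟩, hβb₁₅, hβb₁₆⟩ := hβ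
  have hβ1 : 1 ≤ β := by linarith
  have hβ0 : 0 < β := by linarith
  -- `H`
  obtain ⟨hHl, hHu, hH1⟩ := ceil_rpow_bounds (θ := θ) hβ1
  rw [← hHdef] at hHl hHu hH1
  have hH1r : (1 : ℝ) ≤ H := by exact_mod_cast hH1
  have hH0 : (0 : ℝ) < H := by linarith
  have hθpos : 0 < β ^ θ := Real.rpow_pos_of_pos hβ0 θ
  have hlogβ : 0 ≤ Real.log β := Real.log_nonneg hβ1
  have hLβ : 1 ≤ 1 + Real.log β := by linarith
  have hlogH : 0 ≤ 1 + Real.log (H : ℝ) := one_add_log_nonneg hH1r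
  have hHk : ∀ k : ℕ, (H : ℝ) ^ k ≤ 2 ^ k * β ^ ((k : ℝ) * θ) := fun k => natCast_pow_le hβ1 hθ0 hHu k
  have hlgH : (1 + Real.log (H : ℝ)) ^ 2 ≤ (2 + θ) ^ 2 * (1 + Real.log β) ^ 2 := one_add_log_natCast_pow_le hβ1 hθ0 hH1 hHu 2
  have hHθk : ∀ k : ℕ, β ^ ((k : ℝ) * θ) ≤ (H : ℝ) ^ k := fun k => by
    rw [mul_comm, Real.rpow_mul hβ0.le, Real.rpow_natCast]
    exact pow_le_pow_left₀ hθpos.le hHl k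
  -- `H ≥ 32`
  have hH32 : (32 : ℝ) ≤ H := by
    have h := hb₁₃ β hβb₁₃
    rw [pow_zero, mul_one, div_le_iff₀ hθpos, one_mul] at h
    exact h.trans hHl
  -- `s`, `spl`, `L`
  have hs0 : 0 < s := by rw [hsdef]; exact Real.rpow_pos_of_pos hβ0 _
  have hspl0 : 0 ≤ spl := by rw [hspldef]; exact Real.rpow_nonneg hβ0.le _
  have hs_eq : s = 1 / β ^ (1 / 2 - κ₃) := by
    rw [hsdef, one_div (β ^ (1 / 2 - κ₃)), ← Real.rpow_neg hβ0.le]; ring_nf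
  have hspl_eq : spl = 1 / β ^ (1 / 2 - ε₁) := by
    rw [hspldef, one_div (β ^ (1 / 2 - ε₁)), ← Real.rpow_neg hβ0.le]; ring_nf
  have hs2 : s ^ 2 = β ^ (2 * κ₃ - 1) := by
    rw [hsdef, ← Real.rpow_natCast, ← Real.rpow_mul hβ0.le]; ring_nf
  have hspl2 : spl ^ 2 = β ^ (2 * ε₁ - 1) := by
    rw [hspldef, ← Real.rpow_natCast, ← Real.rpow_mul hβ0.le]; ring_nf
  have hβs2 : β * s ^ 2 = β ^ (2 * κ₃) := by
    rw [hs2, show (2 : ℝ) * κ₃ - 1 = 2 * κ₃ + (-1) by ring, Real.rpow_add hβ0, Real.rpow_neg hβ0.le, Real.rpow_one]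
    field_simp
  -- (S1) `s ≤ 1/100`
  have hs1 : s ≤ 1 / 100 := by
    have h := hb₇ β hβb₇
    rw [pow_zero, mul_one] at h
    rwa [hs_eq]
  -- (S2) `17 s² ≤ spl²`
  have hspls : 17 * s ^ 2 ≤ spl ^ 2 := by
    have h := hb₈ β hβb₈
    rw [pow_zero, mul_one, div_le_iff₀ (Real.rpow_pos_of_pos hβ0 _), one_mul] at h
    rw [hs2, hspl2]
    have e : β ^ (2 * ε₁ - 1) = β ^ (2 * (ε₁ - κ₃)) * β ^ (2 * κ₃ - 1) := by rw [← Real.rpow_add hβ0]; ring_nf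
    rw [e]
    exact mul_le_mul_of_nonneg_right h (Real.rpow_nonneg hβ0.le _)
  -- the gap `1/(H⁴(1+log β)²)` and `r`
  have hgap0 : 0 < 1 / ((H : ℝ) ^ 4 * (1 + Real.log β) ^ 2) := by positivity
  have hr₀0 : 0 ≤ K * H * (1 + Real.log H) ^ 2 * spl := by positivity
  have hr0 : 0 < r := by rw [hrdef]; linarith
  -- bounds on the monomials `K H^k (1+log H)² spl`
  have hmono : ∀ k : ℕ, K * (H : ℝ) ^ k * (1 + Real.log H) ^ 2 * spl =
      K * (H : ℝ) ^ k * (1 + Real.log H) ^ 2 * (1 + Real.log β) ^ 0 / β ^ (1 / 2 - ε₁) := by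
    intro k; rw [hspl_eq, pow_zero, mul_one]; ring
  -- (W4) `spl·H⁴(1+log H)² ≤ c₀₅`
  have hW4 : spl * (H : ℝ) ^ 4 * (1 + Real.log H) ^ 2 ≤ c₀₅ := by
    have h := hb₃ β hβb₃ H hH1 hHu
    rw [pow_zero, mul_one, one_mul] at h
    calc spl * (H : ℝ) ^ 4 * (1 + Real.log H) ^ 2 = (H : ℝ) ^ 4 * (1 + Real.log H) ^ 2 / β ^ (1 / 2 - ε₁) := by rw [hspl_eq]; ring
      _ ≤ c₀₅ := h
  -- (W5) `C₅·(K H (1+log H)² spl)·H² ≤ 1`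
  have hW5 : C₅ * (K * H * (1 + Real.log H) ^ 2 * spl) * (H : ℝ) ^ 2 ≤ 1 := by
    have h := hb₄ β hβb₄ H hH1 hHu
    rw [pow_zero, mul_one] at h
    calc C₅ * (K * H * (1 + Real.log H) ^ 2 * spl) * (H : ℝ) ^ 2 = C₅ * K * (H : ℝ) ^ 3 * (1 + Real.log H) ^ 2 / β ^ (1 / 2 - ε₁) := by
          rw [hspl_eq]; ring
      _ ≤ 1 := h
  -- (W7) `C₅ r H ≤ 1`
  have hW7 : C₅ * r * H ≤ 1 := by
    have h1 := hb₅ β hβb₅ H hH1 hHu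
    rw [pow_zero, mul_one] at h1
    have h2 := hb₆ β hβb₆
    rw [pow_zero, mul_one] at h2
    have h3 : C₅ * (1 / ((H : ℝ) ^ 4 * (1 + Real.log β) ^ 2)) * H ≤ C₅ / β ^ (3 * θ) := by
      have e : C₅ * (1 / ((H : ℝ) ^ 4 * (1 + Real.log β) ^ 2)) * H = C₅ / ((H : ℝ) ^ 3 * (1 + Real.log β) ^ 2) := by
        field_simp
      rw [e]
      refine div_le_div_of_nonneg_left hC₅.le (Real.rpow_pos_of_pos hβ0 _) ?_
      calc β ^ (3 * θ) = β ^ (((3 : ℕ) : ℝ) * θ) := by norm_num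
        _ ≤ (H : ℝ) ^ 3 := hHθk 3
        _ = (H : ℝ) ^ 3 * 1 := (mul_one _).symm
        _ ≤ (H : ℝ) ^ 3 * (1 + Real.log β) ^ 2 := mul_le_mul_of_nonneg_left (one_le_pow₀ hLβ) (by positivity)
    calc C₅ * r * H = C₅ * K * (H : ℝ) ^ 2 * (1 + Real.log H) ^ 2 / β ^ (1 / 2 - ε₁) +
          C₅ * (1 / ((H : ℝ) ^ 4 * (1 + Real.log β) ^ 2)) * H := by rw [hrdef, hspl_eq]; ring
      _ ≤ 1 / 2 + 1 / 2 := add_le_add h1 (h3.trans h2)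
      _ = 1 := by norm_num
  -- (W1) the T-S5.4J window, (W2) `e^{−c₅H⁴} ≤ 1/2`
  have hW1 : C₅ * (H : ℝ) ^ 12 * (1 + Real.log β) ^ 8 ≤ β := by
    have h := hb₁ β hβb₁ H hH1 hHu
    rw [pow_zero, mul_one, Real.rpow_one, div_le_iff₀ hβ0, one_mul] at h
    exact h
  have hδexp : Real.exp (-(c₅ * (H : ℝ) ^ 4)) ≤ Real.exp (-(c₅ * β ^ (4 * θ))) := by
    refine Real.exp_le_exp.2 (neg_le_neg (mul_le_mul_of_nonneg_left ?_ hc₅.le))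
    calc β ^ (4 * θ) = β ^ (((4 : ℕ) : ℝ) * θ) := by norm_num
      _ ≤ (H : ℝ) ^ 4 := hHθk 4
  have hW2 : Real.exp (-(c₅ * (H : ℝ) ^ 4)) ≤ 1 / 2 := by
    have h := hb₂ β hβb₂ H hH1 hHu
    rw [pow_zero, Real.rpow_zero, mul_one, mul_one, one_mul] at h
    exact hδexp.trans h
  -- (T1) `4s ≤ r`, (T2) `r H² ≤ c₀₆`, (T3) `C₆(1+log H) ≤ β s²`
  have hT1 : 4 * s ≤ r := by
    have h := hb₉ β hβb₉
    rw [div_le_iff₀ (Real.rpow_pos_of_pos hβ0 _), one_mul] at h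
    -- `64 (1+log β)² ≤ β^{1/2 − κ₃ − 4θ}` ⇒ `4 β^{κ₃−1/2} · (16 β^{4θ} (1+log β)²) ≤ 1`
    have hH4 : (H : ℝ) ^ 4 ≤ 16 * β ^ (4 * θ) := by
      calc (H : ℝ) ^ 4 ≤ 2 ^ 4 * β ^ (((4 : ℕ) : ℝ) * θ) := hHk 4
        _ = 16 * β ^ (4 * θ) := by norm_num
    have hgap : 1 / (16 * β ^ (4 * θ) * (1 + Real.log β) ^ 2) ≤ 1 / ((H : ℝ) ^ 4 * (1 + Real.log β) ^ 2) :=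
      div_le_div_of_nonneg_left zero_le_one (by positivity) (mul_le_mul_of_nonneg_right hH4 (by positivity))
    have hkey : 4 * s ≤ 1 / (16 * β ^ (4 * θ) * (1 + Real.log β) ^ 2) := by
      rw [hsdef, le_div_iff₀ (by positivity)]
      have hnn : 0 ≤ β ^ (κ₃ - 1 / 2) * β ^ (4 * θ) := mul_nonneg (Real.rpow_nonneg hβ0.le _) (Real.rpow_nonneg hβ0.le _)
      calc 4 * β ^ (κ₃ - 1 / 2) * (16 * β ^ (4 * θ) * (1 + Real.log β) ^ 2)
          = 64 * (1 + Real.log β) ^ 2 * (β ^ (κ₃ - 1 / 2) * β ^ (4 * θ)) := by ring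
        _ ≤ β ^ (1 / 2 - κ₃ - 4 * θ) * (β ^ (κ₃ - 1 / 2) * β ^ (4 * θ)) := mul_le_mul_of_nonneg_right h hnn
        _ = β ^ ((1 / 2 - κ₃ - 4 * θ) + (κ₃ - 1 / 2) + 4 * θ) := by rw [Real.rpow_add hβ0, Real.rpow_add hβ0]; ring
        _ = 1 := by rw [show (1 / 2 - κ₃ - 4 * θ) + (κ₃ - 1 / 2) + 4 * θ = (0 : ℝ) by ring, Real.rpow_zero]
    calc 4 * s ≤ 1 / ((H : ℝ) ^ 4 * (1 + Real.log β) ^ 2) := hkey.trans hgap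
      _ ≤ r := by rw [hrdef]; linarith
  have hT2 : r * (H : ℝ) ^ 2 ≤ c₀₆ := by
    have h1 := hb₁₀ β hβb₁₀ H hH1 hHu
    rw [pow_zero, mul_one] at h1
    have h2 := hb₁₁ β hβb₁₁
    rw [pow_zero, mul_one] at h2
    have h3 : 1 / ((H : ℝ) ^ 4 * (1 + Real.log β) ^ 2) * (H : ℝ) ^ 2 ≤ 1 / β ^ (2 * θ) := by
      have e : 1 / ((H : ℝ) ^ 4 * (1 + Real.log β) ^ 2) * (H : ℝ) ^ 2 = 1 / ((H : ℝ) ^ 2 * (1 + Real.log β) ^ 2) := by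
        field_simp
      rw [e]
      refine div_le_div_of_nonneg_left zero_le_one (Real.rpow_pos_of_pos hβ0 _) ?_
      calc β ^ (2 * θ) = β ^ (((2 : ℕ) : ℝ) * θ) := by norm_num
        _ ≤ (H : ℝ) ^ 2 := hHθk 2
        _ = (H : ℝ) ^ 2 * 1 := (mul_one _).symm
        _ ≤ (H : ℝ) ^ 2 * (1 + Real.log β) ^ 2 := mul_le_mul_of_nonneg_left (one_le_pow₀ hLβ) (by positivity)
    calc r * (H : ℝ) ^ 2 = K * (H : ℝ) ^ 3 * (1 + Real.log H) ^ 2 / β ^ (1 / 2 - ε₁) +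
          1 / ((H : ℝ) ^ 4 * (1 + Real.log β) ^ 2) * (H : ℝ) ^ 2 := by rw [hrdef, hspl_eq]; ring
      _ ≤ c₀₆ / 2 + c₀₆ / 2 := add_le_add h1 (h3.trans h2)
      _ = c₀₆ := by ring
  have hT3 : C₆ * (1 + Real.log H) ≤ β * s ^ 2 := by
    have h := hb₁₂ β hβb₁₂ H hH1 hHu
    rw [pow_zero, pow_one, pow_zero, mul_one, mul_one, div_le_iff₀ (Real.rpow_pos_of_pos hβ0 _), one_mul] at h
    rwa [hβs2]
  -- τ
  have hτint := h6' H hH1 β r s hβ1 hs0 hT1 hT2 hT3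
  have hrH5 : r * (H : ℝ) ^ 5 ≤ 64 * K * (2 + θ) ^ 2 * (β ^ (6 * θ + ε₁ - 1 / 2) * (1 + Real.log β) ^ 2) + 2 * β ^ θ := by
    have h1 : K * (H : ℝ) ^ 6 * (1 + Real.log H) ^ 2 * spl ≤ 64 * K * (2 + θ) ^ 2 * (β ^ (6 * θ + ε₁ - 1 / 2) * (1 + Real.log β) ^ 2) := by
      have hH6 : (H : ℝ) ^ 6 ≤ 64 * β ^ (6 * θ) := by
        calc (H : ℝ) ^ 6 ≤ 2 ^ 6 * β ^ (((6 : ℕ) : ℝ) * θ) := hHk 6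
          _ = 64 * β ^ (6 * θ) := by norm_num
      have e : β ^ (6 * θ + ε₁ - 1 / 2) = β ^ (6 * θ) * β ^ (ε₁ - 1 / 2) := by rw [← Real.rpow_add hβ0]; ring_nf
      rw [e, hspldef]
      have := mul_le_mul (mul_le_mul hH6 hlgH (pow_nonneg hlogH 2) (by positivity)) le_rfl (Real.rpow_nonneg hβ0.le (ε₁ - 1 / 2))
        (by positivity)
      calc K * (H : ℝ) ^ 6 * (1 + Real.log H) ^ 2 * β ^ (ε₁ - 1 / 2) = K * ((H : ℝ) ^ 6 * (1 + Real.log H) ^ 2 * β ^ (ε₁ - 1 / 2)) := by ring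
        _ ≤ K * (64 * β ^ (6 * θ) * ((2 + θ) ^ 2 * (1 + Real.log β) ^ 2) * β ^ (ε₁ - 1 / 2)) := mul_le_mul_of_nonneg_left this hK.le
        _ = 64 * K * (2 + θ) ^ 2 * (β ^ (6 * θ) * β ^ (ε₁ - 1 / 2) * (1 + Real.log β) ^ 2) := by ring
    have h2 : 1 / ((H : ℝ) ^ 4 * (1 + Real.log β) ^ 2) * (H : ℝ) ^ 5 ≤ 2 * β ^ θ := by
      have e : 1 / ((H : ℝ) ^ 4 * (1 + Real.log β) ^ 2) * (H : ℝ) ^ 5 = H / (1 + Real.log β) ^ 2 := by field_simp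
      rw [e]
      calc (H : ℝ) / (1 + Real.log β) ^ 2 ≤ H := div_le_self hH0.le (one_le_pow₀ hLβ)
        _ ≤ 2 * β ^ θ := natCast_le_two_mul_rpow hβ1 hθ0 hHu
    calc r * (H : ℝ) ^ 5 = K * (H : ℝ) ^ 6 * (1 + Real.log H) ^ 2 * spl + 1 / ((H : ℝ) ^ 4 * (1 + Real.log β) ^ 2) * (H : ℝ) ^ 5 := by
          rw [hrdef]; ring
      _ ≤ _ := add_le_add h1 h2
  obtain ⟨τ, hτdef⟩ : ∃ x : ℝ, x = C₆p * (H : ℝ) ^ 4 * Real.exp (2 * C₆p * β ^ θ +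
      64 * K * (2 + θ) ^ 2 * C₆p * β ^ (6 * θ + ε₁ - 1 / 2) * (1 + Real.log β) ^ 2 - c₆ * β ^ (2 * κ₃)) := ⟨_, rfl⟩
  have hτ0 : 0 ≤ τ := by rw [hτdef]; positivity
  have hexp : Real.exp (C₆ * r * (H : ℝ) ^ 5 - c₆ * β * s ^ 2) ≤
      Real.exp (2 * C₆p * β ^ θ + 64 * K * (2 + θ) ^ 2 * C₆p * β ^ (6 * θ + ε₁ - 1 / 2) * (1 + Real.log β) ^ 2 - c₆ * β ^ (2 * κ₃)) := by
    refine Real.exp_le_exp.2 ?_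
    have h1 : C₆ * r * (H : ℝ) ^ 5 ≤ C₆p * (r * (H : ℝ) ^ 5) := by
      rw [mul_assoc]; exact mul_le_mul_of_nonneg_right hC₆le (by positivity)
    have h2 : C₆p * (r * (H : ℝ) ^ 5) ≤ C₆p * (64 * K * (2 + θ) ^ 2 * (β ^ (6 * θ + ε₁ - 1 / 2) * (1 + Real.log β) ^ 2) + 2 * β ^ θ) :=
      mul_le_mul_of_nonneg_left hrH5 hC₆p0
    have h3 : c₆ * β * s ^ 2 = c₆ * β ^ (2 * κ₃) := by rw [mul_assoc, hβs2]
    have h4 : C₆p * (64 * K * (2 + θ) ^ 2 * (β ^ (6 * θ + ε₁ - 1 / 2) * (1 + Real.log β) ^ 2) + 2 * β ^ θ) =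
        2 * C₆p * β ^ θ + 64 * K * (2 + θ) ^ 2 * C₆p * β ^ (6 * θ + ε₁ - 1 / 2) * (1 + Real.log β) ^ 2 := by ring
    linarith
  have hfac : C₆ * (H : ℝ) ^ 4 * Real.exp (C₆ * r * (H : ℝ) ^ 5 - c₆ * β * s ^ 2) ≤ τ := by
    rw [hτdef]
    calc C₆ * (H : ℝ) ^ 4 * Real.exp (C₆ * r * (H : ℝ) ^ 5 - c₆ * β * s ^ 2)
        ≤ C₆p * (H : ℝ) ^ 4 * Real.exp (C₆ * r * (H : ℝ) ^ 5 - c₆ * β * s ^ 2) :=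
          mul_le_mul_of_nonneg_right (mul_le_mul_of_nonneg_right hC₆le (by positivity)) (Real.exp_pos _).le
      _ ≤ C₆p * (H : ℝ) ^ 4 * Real.exp (2 * C₆p * β ^ θ + 64 * K * (2 + θ) ^ 2 * C₆p * β ^ (6 * θ + ε₁ - 1 / 2) *
          (1 + Real.log β) ^ 2 - c₆ * β ^ (2 * κ₃)) := mul_le_mul_of_nonneg_left hexp (by positivity)
  have hI0 : 0 ≤ ∫ a in smallField H (s / 2), fpChartWeight β H r a :=
    setIntegral_nonneg (ChartGauss.measurableSet_smallField _) fun a _ => FPChart.fpChartWeight_nonneg β r a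
  have hτ : ∫ a in chartDomain H \ smallField H s, fpChartWeight β H r a ≤ τ * ∫ a in smallField H (s / 2), fpChartWeight β H r a :=
    hτint.trans (mul_le_mul_of_nonneg_right hfac hI0)
  -- Steps A+B+C (absolute)
  have habs := hwin H hH1 β spl r s τ T hβ2 hW1 hW2 hspl0 hW4 hW5 (by rw [hrdef]) hW7 hs0.le hs1 hspls hτ0 hτ
  -- the floor
  have hMT : M_D * (T : ℝ) ≤ (H : ℝ) / 8 := by
    have : 8 * M_D * (T : ℝ) ≤ H := by rw [hHdef]; exact hMT
    linarith
  have hσ := hfloor H hH32 T hMT hLT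
  have hσdef : 3 / (32 * π ^ 4) / (H : ℝ) ^ 8 = 1 / (32 * π ^ 4 / 3 * (H : ℝ) ^ 8) := by field_simp
  -- the three error terms against `σ/24`
  have hE1 : 200 * β ^ 2 * Real.exp (-(c₅ * (H : ℝ) ^ 4)) ≤ 1 / (32 * π ^ 4 / 3 * (H : ℝ) ^ 8) / 24 := by
    have h := hb₁₄ β hβb₁₄ H hH1 hHu
    rw [Real.rpow_two] at h
    rw [le_div_iff₀ (by norm_num : (0 : ℝ) < 24), le_div_iff₀ (by positivity)]
    calc 200 * β ^ 2 * Real.exp (-(c₅ * (H : ℝ) ^ 4)) * 24 * (32 * π ^ 4 / 3 * (H : ℝ) ^ 8)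
        = Q * (H : ℝ) ^ 8 * β ^ 2 * Real.exp (-(c₅ * (H : ℝ) ^ 4)) := by rw [hQ]; ring
      _ ≤ Q * (H : ℝ) ^ 8 * β ^ 2 * Real.exp (-(c₅ * β ^ (4 * θ))) := mul_le_mul_of_nonneg_left hδexp (by positivity)
      _ ≤ 1 := h
  have hE2 : 200 * β ^ 2 * ((boxState (fundamentalRep (Fin 2)) β H) {U | ¬ SmallPlaquettes H spl U}).toReal ≤
      1 / (32 * π ^ 4 / 3 * (H : ℝ) ^ 8) / 24 := by
    have h := hb₁₅ β hβb₁₅ H hH1 hHu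
    rw [Real.rpow_two, one_mul] at h
    have hpβ := hp β hββ₁
    rw [← hHdef, ← hspldef] at hpβ
    rw [le_div_iff₀ (by norm_num : (0 : ℝ) < 24), le_div_iff₀ (by positivity)]
    calc 200 * β ^ 2 * ((boxState (fundamentalRep (Fin 2)) β H) {U | ¬ SmallPlaquettes H spl U}).toReal * 24 * (32 * π ^ 4 / 3 * (H : ℝ) ^ 8)
        = Q * (H : ℝ) ^ 8 * β ^ 2 * ((boxState (fundamentalRep (Fin 2)) β H) {U | ¬ SmallPlaquettes H spl U}).toReal := by rw [hQ]; ring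
      _ ≤ Q * (H : ℝ) ^ 8 * β ^ 2 * Real.exp (-(β ^ ε₁)) := mul_le_mul_of_nonneg_left hpβ (by positivity)
      _ ≤ 1 := h
  have hE3 : 200 * β ^ 2 * τ ≤ 1 / (32 * π ^ 4 / 3 * (H : ℝ) ^ 8) / 24 := by
    have h := hb₁₆ β hβb₁₆ H hH1 hHu
    rw [Real.rpow_two] at h
    rw [le_div_iff₀ (by norm_num : (0 : ℝ) < 24), le_div_iff₀ (by positivity)]
    calc 200 * β ^ 2 * τ * 24 * (32 * π ^ 4 / 3 * (H : ℝ) ^ 8)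
        = Q * C₆p * (H : ℝ) ^ 12 * β ^ 2 * Real.exp (2 * C₆p * β ^ θ + 64 * K * (2 + θ) ^ 2 * C₆p * β ^ (6 * θ + ε₁ - 1 / 2) *
            (1 + Real.log β) ^ 2 - c₆ * β ^ (2 * κ₃)) := by rw [hτdef, hQ]; ring
      _ ≤ 1 := h
  -- conclusion (abstractly, to avoid re-elaborating the chart covariance)
  have key : ∀ X Y : ℝ, |X - Y| ≤ 200 * (Real.exp (-(c₅ * (H : ℝ) ^ 4)) +
      ((boxState (fundamentalRep (Fin 2)) β H) {U | ¬ SmallPlaquettes H spl U}).toReal + τ) →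
      |β ^ 2 * X - β ^ 2 * Y| ≤ 1 / 8 * (3 / 4 * boxDirCircSqCov H T) := by
    intro X Y hXY
    have hβ2sq : 0 ≤ β ^ 2 := sq_nonneg β
    rw [← mul_sub, abs_mul, abs_of_nonneg hβ2sq]
    calc β ^ 2 * |X - Y|
        ≤ β ^ 2 * (200 * (Real.exp (-(c₅ * (H : ℝ) ^ 4)) + ((boxState (fundamentalRep (Fin 2)) β H) {U | ¬ SmallPlaquettes H spl U}).toReal + τ)) :=
          mul_le_mul_of_nonneg_left hXY hβ2sq
      _ = 200 * β ^ 2 * Real.exp (-(c₅ * (H : ℝ) ^ 4)) + 200 * β ^ 2 * ((boxState (fundamentalRep (Fin 2)) β H) {U | ¬ SmallPlaquettes H spl U}).toReal +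
            200 * β ^ 2 * τ := by ring
      _ ≤ 1 / (32 * π ^ 4 / 3 * (H : ℝ) ^ 8) / 24 + 1 / (32 * π ^ 4 / 3 * (H : ℝ) ^ 8) / 24 + 1 / (32 * π ^ 4 / 3 * (H : ℝ) ^ 8) / 24 :=
          add_le_add (add_le_add hE1 hE2) hE3
      _ = 1 / 8 * (3 / (32 * π ^ 4) / (H : ℝ) ^ 8) := by rw [hσdef]; ring
      _ ≤ 1 / 8 * (3 / 4 * boxDirCircSqCov H T) := mul_le_mul_of_nonneg_left hσ (by norm_num)
  exact key _ _ habs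

end BoxToChart

end Summit.QuantumFields.YangMills.Theorems.AllWindowsColdBoxBoxHighLine

end
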